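import Summits.ABC.StewartYu.PadicTwistSetup
import Summits.ABC.StewartYu.PadicTwistExistsAnyOrder
import HarnessLib

/-!
# Cell abc-stewartyu, WP-Y provider B (xii): the twisted set-up EXISTS at every odd prime with twist order
# `G = p − 1` and twisting roots `ηᵢ = ζ^{rᵢ}` (one primitive `(p−1)`-th root `ζ`)

`Summits/ABC/StewartYu/PadicTwistPMExists.lean` — cell `abc-stewartyu`, seat p3 (crux `W80OneModFour`
stmt-ABC-19487; memo-05 §5 B6). From generators `α, θ` that are rational `p`-adic units and coefficients
`b, b_θ` (`b_θ ≠ 0` of minimal order), a `TwistSetup` (p2's re-landed any-order structure) with `G = p − 1`,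
`ηᵢ = ζ^{rᵢ}` for a primitive `(p−1)`-th root of unity `ζ ∈ ℚ_p` with `ζ^{(p−1)/2} = −1`, `‖ζ‖ = 1`
(`PadicTwistExistsAnyOrder`), carrying the prescribed algebraic datum. This is the level-free input of the
`p ≡ 1 (mod 4)` provider (the exponent data `(ζ, r)` feeds `PadicTwistPMExpClass` / `PMHalfValues`).
[folklore] algebra; no named fact.
-/

noncomputable section

open Finset

namespace Summit.ABC.StewartYu

namespace TwistSetup

variable {p : ℕ} [Fact p.Prime]

/-- **Existence of the twisted set-up of order `p − 1`** with `ηᵢ = ζ^{rᵢ}`. [folklore] -/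
theorem exists_anyOrder (hp3 : 3 ≤ p) {d : ℕ} (α : Fin d → ℚ) (θ : ℚ) (hα : ∀ j, α j ≠ 0)
    (hθ : θ ≠ 0) (hvα : ∀ j, padicValRat p (α j) = 0) (hvθ : padicValRat p θ = 0)
    (b : Fin d → ℤ) (bθ : ℤ) (hbθ : bθ ≠ 0)
    (hbmin : ∀ j, b j ≠ 0 → padicValInt p bθ ≤ padicValInt p (b j)) :
    ∃ (S : TwistSetup p) (ζ : ℚ_[p]) (r : Fin (d + 1) → ℕ),
      S.d = d ∧ HEq S.α α ∧ S.θ = θ ∧ HEq S.b b ∧ S.bθ = bθ ∧ S.G = p - 1 ∧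
      IsPrimitiveRoot ζ (p - 1) ∧ ζ ^ ((p - 1) / 2) = -1 ∧ ‖ζ‖ = 1 ∧
      (∀ i, r i < p - 1) ∧ HEq S.η (fun i : Fin (d + 1) => ζ ^ r i) := by
  obtain ⟨ζ, hζ, hζM, hζ1⟩ := TwistExistsAnyOrder.exists_primitiveRoot (p := p) hp3
  -- all generators, `θ` last
  set a : Fin (d + 1) → ℚ := Fin.snoc α θ with ha
  have ha_ne : ∀ i, a i ≠ 0 := by
    intro i; simp only [ha]
    refine Fin.lastCases ?_ (fun j => ?_) i
    · simpa using hθ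
    · simpa using hα j
  have hva : ∀ i, padicValRat p (a i) = 0 := by
    intro i; simp only [ha]
    refine Fin.lastCases ?_ (fun j => ?_) i
    · simpa using hvθ
    · simpa using hvα j
  obtain ⟨r, hr⟩ := TwistExistsAnyOrder.twist_exists_family_anyOrder hζ1 hζ a ha_ne hva
  have hG : 0 < p - 1 := by omega
  refine ⟨⟨hp3, d, α, θ, hα, hθ, b, bθ, hbθ, hbmin, p - 1, hG, fun i => ζ ^ r i, ?_, ?_⟩,
    ζ, r, rfl, HEq.rfl, rfl, HEq.rfl, rfl, rfl, hζ, hζM, hζ1, fun i => (hr i).1, HEq.rfl⟩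
  · intro i
    rw [← pow_mul, mul_comm, pow_mul, hζ.pow_eq_one, one_pow]
  · intro i
    exact (hr i).2

end TwistSetup

end Summit.ABC.StewartYu

end
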